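import Summits.AtomisticToContinuum.Crystallization.Theorems.ChartedPlanarOrderChannelJacobianForce
import Mathlib.Analysis.Calculus.Deriv.MeanValue
import Mathlib.Analysis.InnerProductSpace.Calculus
import Mathlib.Analysis.Calculus.SmoothSeries

/-!
# Charted planar order — the channel JACOBIAN: Hessian-certificate ingestion format for the channel leaves (lens-3, g25 Part B; TAG 182)
— part 2/2 (§5: ingestion, endpoint, series form)

The four channel leaves of record (`…TubeChannelsTS.AdjacentChannelRefT/S`, `FarChannelBelowRefT/S`) bound the SECANT form
`⟪G u − G u′, u − u′⟫` of the offset map `G u = layerForce a b (−u)` on convex windows (`tube w' (1/40) m`, resp. the span balls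
`closedBall (w' l − w' k) (s/40)`). This module turns them into statements a finite certificate can discharge:

* §1 a monotone-operator lemma (mean value along the segment): a lower bound `Q` for the Jacobian form `⟪J(x)D, D⟫`, `D = u − u′`, on the
  window gives `Q ≤` secant form; block bounds `(α_T, α_N, γ)` (tangential / normal / cross, w.r.t. a unit normal `ν`) with a weight `θ`
  give the channel constants `l_T = α_T − θγ`, `l_N = α_N − γ/θ` (`channel_of_blocks`); hence `IsAdjacentChannelMono` /
  `IsFarChannelModulusBelow` from Jacobian block bounds (`…_of_jacobian`, `…_of_blocks`).
* §2–§3 the explicit PAIR JACOBIAN `pairJac x = radial(‖x‖²)·id + 2 radial′(‖x‖²)·(x ⊗ x)` of `pairForce x = (‖x‖⁻¹⁴ − ‖x‖⁻⁸) x`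
  (`hasFDerivAt_pairForce`, `x ≠ 0`) with the operator-norm bound `‖pairJac x‖ ≤ modulus r` for `‖x‖ ≥ r > 0`.
* §4 the LAYER JACOBIAN `layerJac a b v = Σ_{ℤ²} pairJac (v + l)` and `HasFDerivAt (layerForce a b) (layerJac a b v) v` off the layer
  plane (termwise differentiation with the summable majorant of `…LatticeSmear.tsum_modulus_le_smear` on a `d`-ball).
* §5 INGESTION: the interlayer Hessian `hess a b u = −layerJac a b (−u)`; on the configurations of record every window point is regular
  (`regularWindows`: heights `≥ 31/50` w.r.t. a unit normal, cell radius `≤ 23/25`), so Hessian block bounds ALONE give the leaves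
  (`isAdjacentChannelMono_of_hess`, `isFarChannelModulusBelow_of_hess`, the Ref wrappers `adjacentChannelRefT/S_of_hess`,
  `farChannelBelowRefT/S_of_hess` from the certificate predicates `HessCertAdj Φ α_T α_N γ`, `HessCertFar Φ α_T α_N γ s₀`), and the
  ENDPOINT `tubeConvexRef_of_hessCerts₆`: four Hessian certificates (adjacent + spans `2..5`, T and S branch) + weights + the closing
  arithmetic of `…PairModulusSharp.tubeConvexRef_record_of_branch_certs₆` ⇒ `TubeConvexRef (17/16) (1/40)`; and the Hessian form as an
  absolutely convergent lattice series of explicit rational functions (`inner_hess_eq_tsum`, `inner_pairJac`) for matching a computed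
  truncation against `hess`.

No `sorry`; axioms `propext, Classical.choice, Quot.sound`.
-/

noncomputable section

namespace Summit.AtomisticToContinuum.Crystallization.Theorems.ChartedPlanarOrderChannelJacobian

open Metric Set
open scoped RealInnerProductSpace
open Summit.AtomisticToContinuum.Crystallization.Theorems.ChartedPlanarOrderRigidityDoor (E3)
open Summit.AtomisticToContinuum.Crystallization.Theorems.ChartedPlanarOrderProfileSlavingLJ (pairForce layerForce incr offsetOf tube)
open Summit.AtomisticToContinuum.Crystallization.Theorems.ChartedPlanarOrderTubeMonotoneSplit (norm_offsetOf_sub_le)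
open Summit.AtomisticToContinuum.Crystallization.Theorems.ChartedPlanarOrderTubeChannels (tng IsAdjacentChannelMono IsFarChannelModulusBelow)
open Summit.AtomisticToContinuum.Crystallization.Theorems.ChartedPlanarOrderPairModulus (modulus modulus_nonneg exists_planar
  summable_layer)
open Summit.AtomisticToContinuum.Crystallization.Theorems.ChartedPlanarOrderStackedLayerGeometry (inner_period_combo)
open Summit.AtomisticToContinuum.Crystallization.Theorems.ChartedPlanarOrderLayerFrame (norm_sq_add_smul_normal norm_sq_eq_planar_add_height)
open Summit.AtomisticToContinuum.Crystallization.Theorems.ChartedPlanarOrderLatticeSmear (norm_sq_lin tsum_modulus_le_smear)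
open Summit.AtomisticToContinuum.Crystallization.Theorems.ChartedPlanarOrderHeightFloor (cleanStackedWindows)
open Summit.AtomisticToContinuum.Crystallization.Theorems.ChartedPlanarOrderLayerForceLipschitz (le_inner_offsetOf)
open Summit.AtomisticToContinuum.Crystallization.Theorems.ChartedPlanarOrderDensityDichotomy (IsSep μS)
open Summit.AtomisticToContinuum.Crystallization.Theorems.ChartedPlanarOrderDoorLayered (Layered)
open Summit.AtomisticToContinuum.Crystallization.Theorems.ChartedPlanarOrderProfileSlavingLJ (IsStacked gapStress)
open Summit.AtomisticToContinuum.Crystallization.Theorems.OverbindingBudgetScaleWidening (IsCleanW)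
open Summit.AtomisticToContinuum.Crystallization.Theorems.OverbindingBudgetPeriodicCleanOrStrained (UniformlyClean)
open Summit.AtomisticToContinuum.Crystallization.Theorems.ChartedPlanarOrderTubeConvex (TubeConvexRef)
open Summit.AtomisticToContinuum.Crystallization.Theorems.ChartedPlanarOrderTubeChannelsTS (AdjacentChannelRefT AdjacentChannelRefS
  FarChannelBelowRefT FarChannelBelowRefS)
open Summit.AtomisticToContinuum.Crystallization.Theorems.ChartedPlanarOrderPairModulusSharp (tubeConvexRef_record_of_branch_certs₆)

/-! ## §5 INGESTION: the channel leaves of record from HESSIAN CERTIFICATES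

The interlayer Hessian at the offset `u` (upper layer over lower) is `hess a b u = −layerJac a b (−u) = Σ_{l ∈ ℤa+ℤb} −J(l − u)`, the Jacobian
of the offset map `u ↦ layerForce a b (−u)` whose secant form the channel leaves bound (§1). On the configurations of record (uniformly clean,
stacked, `‖a‖, ‖b‖ ≤ 17/16`) every window point has height `≥ 119/200 ≥ 13/25` w.r.t. a unit normal and the cell radius is `≤ 23/25`, so the
offset map is differentiable there (§4 with `t = ½, d = 1/50, ε = 4`) and block bounds on `⟪hess a b x D, D⟫` over the windows are ALL a
certificate has to supply. -/

/-- the INTERLAYER HESSIAN at the offset `u`: `−layerJac a b (−u)`. -/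
def hess (a b u : E3) : E3 →L[ℝ] E3 := -layerJac a b (-u)

/-- a point of the `r`-ball round `c` has height `≥ ⟪ν, c⟫ − r` (`ν` a unit vector). -/
theorem le_inner_of_mem_closedBall {ν c x : E3} {r : ℝ} (hν : ‖ν‖ = 1) (hx : x ∈ closedBall c r) : ⟪ν, c⟫ - r ≤ ⟪ν, x⟫ := by
  rw [mem_closedBall, dist_eq_norm] at hx
  have h1 : |⟪ν, x - c⟫| ≤ ‖x - c‖ := by simpa [hν] using abs_real_inner_le_norm ν (x - c)
  rw [inner_sub_right] at h1
  linarith [(abs_le.1 h1).1]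

/-- ★ REGULAR WINDOWS of record: a unit normal `ν₀ ⊥ a, b` with all increment heights `≥ 31/50`, and cell radius `≤ 23/25`
(from `…HeightFloor.cleanStackedWindows`). -/
theorem regularWindows {a b : E3} {w' : ℤ → E3} (hst : IsStacked a b w') (hab : LinearIndependent ℝ ![a, b]) (ha : ‖a‖ ≤ 17 / 16)
    (hb : ‖b‖ ≤ 17 / 16) (hUC : UniformlyClean (Layered a b w')) :
    ∃ ν₀ : E3, ‖ν₀‖ = 1 ∧ ⟪ν₀, a⟫ = 0 ∧ ⟪ν₀, b⟫ = 0 ∧ (∀ i : ℤ, 31 / 50 ≤ ⟪ν₀, incr w' i⟫) ∧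
      ∀ ζ₁ ζ₂ : ℝ, |ζ₁| ≤ 1 / 2 → |ζ₂| ≤ 1 / 2 → ‖ζ₁ • a + ζ₂ • b‖ ≤ 23 / 25 := by
  obtain ⟨ν, a', hν, hνa, hνb, ha'lo, ha'hi, ⟨halo, hahi⟩, ⟨hblo, hbhi⟩, hp, -, -, -, hfl, -⟩ := cleanStackedWindows hst hab ha hb hUC
  refine ⟨ν, hν, hνa, hνb, fun i => le_trans (by nlinarith) (hfl i), fun ζ₁ ζ₂ h₁ h₂ => ?_⟩
  have hsq : ‖ζ₁ • a + ζ₂ • b‖ ^ 2 ≤ (23 / 25) ^ 2 := by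
    rw [norm_sq_lin]
    have hz1 : ζ₁ ^ 2 ≤ 1 / 4 := by have := abs_le.1 h₁; nlinarith
    have hz2 : ζ₂ ^ 2 ≤ 1 / 4 := by have := abs_le.1 h₂; nlinarith
    have hz12 : |ζ₁ * ζ₂| ≤ 1 / 4 := by
      rw [abs_mul]; nlinarith [abs_nonneg ζ₁, abs_nonneg ζ₂]
    have hxa : ‖a‖ ^ 2 * ζ₁ ^ 2 ≤ ‖a‖ ^ 2 * (1 / 4) := mul_le_mul_of_nonneg_left hz1 (by positivity)
    have hyb : ‖b‖ ^ 2 * ζ₂ ^ 2 ≤ ‖b‖ ^ 2 * (1 / 4) := mul_le_mul_of_nonneg_left hz2 (by positivity)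
    have hpz : 2 * ⟪a, b⟫ * (ζ₁ * ζ₂) ≤ 2 * |⟪a, b⟫| * (1 / 4) := by
      have h1 := le_abs_self (⟪a, b⟫ * (ζ₁ * ζ₂))
      rw [abs_mul] at h1
      nlinarith [abs_nonneg ⟪a, b⟫]
    have hx : ‖a‖ ^ 2 ≤ (51 / 50) ^ 2 := pow_le_pow_left₀ (norm_nonneg _) (hahi.trans (by linarith)) 2
    have hy : ‖b‖ ^ 2 ≤ (51 / 50) ^ 2 := pow_le_pow_left₀ (norm_nonneg _) (hbhi.trans (by linarith)) 2
    have hc : (47 / 50 * (49 / 50) : ℝ) ^ 2 ≤ (a' * (49 / 50)) ^ 2 := pow_le_pow_left₀ (by norm_num) (by linarith) 2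
    nlinarith [abs_nonneg ⟪a, b⟫]
  exact (pow_le_pow_iff_left₀ (norm_nonneg _) (by norm_num) two_ne_zero).1 hsq

/-- ★ the offset map is differentiable, with Jacobian `hess a b x`, at every `x` of height `≥ 13/25` w.r.t. a unit normal `ν₀ ⊥ a, b` when the
cell radius is `≤ 23/25` (§4 with `t = ½`, `d = 1/50`, `ε = 4`). -/
theorem hasFDerivAt_offset {ν₀ a b x : E3} (hν : ‖ν₀‖ = 1) (hνa : ⟪ν₀, a⟫ = 0) (hνb : ⟪ν₀, b⟫ = 0) (hab : LinearIndependent ℝ ![a, b])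
    (hRc : ∀ ζ₁ ζ₂ : ℝ, |ζ₁| ≤ 1 / 2 → |ζ₂| ≤ 1 / 2 → ‖ζ₁ • a + ζ₂ • b‖ ≤ 23 / 25) (hx : 13 / 25 ≤ |⟪ν₀, x⟫|) :
    HasFDerivAt (fun u => layerForce a b (-u)) (hess a b x) x :=
  hasFDerivAt_layerForce_neg hν hνa hνb hab (t := 1 / 2) (d := 1 / 50) (Rc := 23 / 25) (ε := 4) (by norm_num) (by norm_num) (by norm_num)
    hRc (by norm_num) (by linarith)

/-- ★★ CONFIGURATION-LEVEL INGESTION, adjacent windows: block bounds `A_T ≥ α_T`, `A_N ≥ α_N`, `|cross| ≤ γ` for the quadratic form of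
`hess a b x` on every `x ∈ tube w' (1/40) m`, and a weight `θ > 0` with `l_T ≤ α_T − θγ`, `l_N ≤ α_N − γ/θ` ⇒ `CHᴬ(l_T, l_N)` (any unit `ν`). -/
theorem isAdjacentChannelMono_of_hess {a b : E3} {w' : ℤ → E3} (hst : IsStacked a b w') (hab : LinearIndependent ℝ ![a, b])
    (ha : ‖a‖ ≤ 17 / 16) (hb : ‖b‖ ≤ 17 / 16) (hUC : UniformlyClean (Layered a b w')) {ν : E3} {αT αN γ θ lT lN : ℝ}
    (hB : ∀ m : ℤ, ∀ x ∈ tube w' (1 / 40) m, ∀ D : E3,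
      αT * ‖tng ν D‖ ^ 2 + αN * ⟪ν, D⟫ ^ 2 - 2 * γ * (‖tng ν D‖ * |⟪ν, D⟫|) ≤ ⟪hess a b x D, D⟫)
    (hθ : 0 < θ) (hγ : 0 ≤ γ) (hlT : lT ≤ αT - θ * γ) (hlN : lN ≤ αN - γ / θ) : IsAdjacentChannelMono a b w' (1 / 40) ν lT lN := by
  obtain ⟨ν₀, hν, hνa, hνb, hfl, hRc⟩ := regularWindows hst hab ha hb hUC
  refine isAdjacentChannelMono_of_blocks (J := hess a b) (fun m u hu => hasFDerivAt_offset hν hνa hνb hab hRc ?_) hB hθ hγ hlT hlN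
  have h1 := le_inner_of_mem_closedBall hν hu
  have h2 : 31 / 50 ≤ ⟪ν₀, incr w' m⟫ := hfl m
  rw [le_abs]; left; linarith

/-- ★★ CONFIGURATION-LEVEL INGESTION, span windows `2 ≤ s < s₀`: block bounds `A_T ≥ −α_T(s)`, `A_N ≥ −α_N(s)`, `|cross| ≤ γ(s)` for the form
of `hess a b x` on every `x ∈ closedBall (w' l − w' k) (s/40)`, `s = l − k`, weights `θ(s) > 0`, `μ_T(s) ≥ α_T(s) + θγ`, `μ_N(s) ≥ α_N(s) + γ/θ`
⇒ `CHꜰ` below `s₀` (any unit `ν`). -/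
theorem isFarChannelModulusBelow_of_hess {a b : E3} {w' : ℤ → E3} (hst : IsStacked a b w') (hab : LinearIndependent ℝ ![a, b])
    (ha : ‖a‖ ≤ 17 / 16) (hb : ‖b‖ ≤ 17 / 16) (hUC : UniformlyClean (Layered a b w')) {ν : E3} {μT μN : ℕ → ℝ} {s₀ : ℕ}
    {αT αN γ θ : ℕ → ℝ}
    (hB : ∀ k l : ℤ, k + 2 ≤ l → (l - k).toNat < s₀ → ∀ x ∈ closedBall (w' l - w' k) ((l - k).toNat * (1 / 40 : ℝ)), ∀ D : E3,
      -(αT (l - k).toNat) * ‖tng ν D‖ ^ 2 + -(αN (l - k).toNat) * ⟪ν, D⟫ ^ 2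
        - 2 * γ (l - k).toNat * (‖tng ν D‖ * |⟪ν, D⟫|) ≤ ⟪hess a b x D, D⟫)
    (hθ : ∀ s, 0 < θ s) (hγ : ∀ s, 0 ≤ γ s) (hμT : ∀ s, αT s + θ s * γ s ≤ μT s) (hμN : ∀ s, αN s + γ s / θ s ≤ μN s) :
    IsFarChannelModulusBelow a b w' (1 / 40) ν μT μN s₀ := by
  obtain ⟨ν₀, hν, hνa, hνb, hfl, hRc⟩ := regularWindows hst hab ha hb hUC
  refine isFarChannelModulusBelow_of_blocks (J := hess a b) (fun k l hkl hs u hu => hasFDerivAt_offset hν hνa hνb hab hRc ?_) hB hθ hγ hμT hμN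
  have hc : ((l - k : ℤ) : ℝ) * (31 / 50 - 0) ≤ ⟪ν₀, w' l - w' k⟫ := by
    have := le_inner_offsetOf (h := incr w') (η := 0) hν (fun i => mem_closedBall_self le_rfl) hfl (show k ≤ l by omega)
    rwa [Summit.AtomisticToContinuum.Crystallization.Theorems.ChartedPlanarOrderProfileSlavingLJ.offsetOf_incr w' (by omega)] at this
  have hn : (((l - k).toNat : ℕ) : ℝ) = ((l - k : ℤ) : ℝ) := by
    have : (((l - k).toNat : ℕ) : ℤ) = l - k := by omega
    exact_mod_cast this
  have h2 : (2 : ℝ) ≤ ((l - k : ℤ) : ℝ) := by exact_mod_cast (show (2 : ℤ) ≤ l - k by omega)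
  have h1 := le_inner_of_mem_closedBall hν hu
  rw [hn] at h1
  rw [le_abs]; left; nlinarith

/-! ### Ref-level wrappers (the four leaves of `…TubeChannelsTS`) and the closing consumer of record -/

/-- HESSIAN CERTIFICATE, adjacent windows, branch predicate `Φ a b`: block bounds `(α_T, α_N, γ)` for `hess` on every adjacent window of every
configuration of record satisfying `Φ`, for every unit normal. -/
def HessCertAdj (Φ : E3 → E3 → Prop) (αT αN γ : ℝ) : Prop :=
  ∀ δ : ℝ, 0 < δ → ∀ (a b : E3) (w' : ℤ → E3), IsStacked a b w' → LinearIndependent ℝ ![a, b] → ‖a‖ ≤ 17 / 16 → ‖b‖ ≤ 17 / 16 →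
    IsSep δ (Layered a b w') → IsCleanW (μS (Layered a b w')) → (∀ m : ℤ, gapStress a b m (incr w') = 0) →
    UniformlyClean (Layered a b w') → Φ a b →
    ∀ ν : E3, ‖ν‖ = 1 → ⟪ν, a⟫ = 0 → ⟪ν, b⟫ = 0 → ∀ m : ℤ, ∀ x ∈ tube w' (1 / 40) m, ∀ D : E3,
      αT * ‖tng ν D‖ ^ 2 + αN * ⟪ν, D⟫ ^ 2 - 2 * γ * (‖tng ν D‖ * |⟪ν, D⟫|) ≤ ⟪hess a b x D, D⟫

/-- HESSIAN CERTIFICATE, span windows `2 ≤ s < s₀`, branch predicate `Φ a b`: softening block bounds `(α_T(s), α_N(s), γ(s))`. -/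
def HessCertFar (Φ : E3 → E3 → Prop) (αT αN γ : ℕ → ℝ) (s₀ : ℕ) : Prop :=
  ∀ δ : ℝ, 0 < δ → ∀ (a b : E3) (w' : ℤ → E3), IsStacked a b w' → LinearIndependent ℝ ![a, b] → ‖a‖ ≤ 17 / 16 → ‖b‖ ≤ 17 / 16 →
    IsSep δ (Layered a b w') → IsCleanW (μS (Layered a b w')) → (∀ m : ℤ, gapStress a b m (incr w') = 0) →
    UniformlyClean (Layered a b w') → Φ a b →
    ∀ ν : E3, ‖ν‖ = 1 → ⟪ν, a⟫ = 0 → ⟪ν, b⟫ = 0 →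
    ∀ k l : ℤ, k + 2 ≤ l → (l - k).toNat < s₀ → ∀ x ∈ closedBall (w' l - w' k) ((l - k).toNat * (1 / 40 : ℝ)), ∀ D : E3,
      -(αT (l - k).toNat) * ‖tng ν D‖ ^ 2 + -(αN (l - k).toNat) * ⟪ν, D⟫ ^ 2
        - 2 * γ (l - k).toNat * (‖tng ν D‖ * |⟪ν, D⟫|) ≤ ⟪hess a b x D, D⟫

/-- the T-branch predicate of record. -/
def PhiT (a b : E3) : Prop := 95 / 289 * ‖a‖ ^ 2 ≤ |⟪a, b⟫|

/-- the S-branch predicate of record. -/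
def PhiS (a b : E3) : Prop := |⟪a, b⟫| ≤ 11 / 75 * ‖a‖ ^ 2

/-- ★ CHᴬ-Ref-T from an adjacent Hessian certificate. -/
theorem adjacentChannelRefT_of_hess {αT αN γ θ lT lN : ℝ} (hC : HessCertAdj PhiT αT αN γ) (hθ : 0 < θ) (hγ : 0 ≤ γ)
    (hlT : lT ≤ αT - θ * γ) (hlN : lN ≤ αN - γ / θ) : AdjacentChannelRefT (17 / 16) (1 / 40) lT lN :=
  fun δ hδ a b w' hst hab ha hb hs hc hg hUC hT ν hν hνa hνb =>
    isAdjacentChannelMono_of_hess hst hab ha hb hUC (hC δ hδ a b w' hst hab ha hb hs hc hg hUC hT ν hν hνa hνb) hθ hγ hlT hlN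

/-- ★ CHᴬ-Ref-S from an adjacent Hessian certificate. -/
theorem adjacentChannelRefS_of_hess {αT αN γ θ lT lN : ℝ} (hC : HessCertAdj PhiS αT αN γ) (hθ : 0 < θ) (hγ : 0 ≤ γ)
    (hlT : lT ≤ αT - θ * γ) (hlN : lN ≤ αN - γ / θ) : AdjacentChannelRefS (17 / 16) (1 / 40) lT lN :=
  fun δ hδ a b w' hst hab ha hb hs hc hg hUC hS ν hν hνa hνb =>
    isAdjacentChannelMono_of_hess hst hab ha hb hUC (hC δ hδ a b w' hst hab ha hb hs hc hg hUC hS ν hν hνa hνb) hθ hγ hlT hlN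

/-- ★ CHꜰ-Ref-T below `s₀` from a span Hessian certificate. -/
theorem farChannelBelowRefT_of_hess {αT αN γ θ μT μN : ℕ → ℝ} {s₀ : ℕ} (hC : HessCertFar PhiT αT αN γ s₀) (hθ : ∀ s, 0 < θ s)
    (hγ : ∀ s, 0 ≤ γ s) (hμT : ∀ s, αT s + θ s * γ s ≤ μT s) (hμN : ∀ s, αN s + γ s / θ s ≤ μN s) :
    FarChannelBelowRefT (17 / 16) (1 / 40) μT μN s₀ :=
  fun δ hδ a b w' hst hab ha hb hs hc hg hUC hT ν hν hνa hνb =>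
    isFarChannelModulusBelow_of_hess hst hab ha hb hUC (hC δ hδ a b w' hst hab ha hb hs hc hg hUC hT ν hν hνa hνb) hθ hγ hμT hμN

/-- ★ CHꜰ-Ref-S below `s₀` from a span Hessian certificate. -/
theorem farChannelBelowRefS_of_hess {αT αN γ θ μT μN : ℕ → ℝ} {s₀ : ℕ} (hC : HessCertFar PhiS αT αN γ s₀) (hθ : ∀ s, 0 < θ s)
    (hγ : ∀ s, 0 ≤ γ s) (hμT : ∀ s, αT s + θ s * γ s ≤ μT s) (hμN : ∀ s, αN s + γ s / θ s ≤ μN s) :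
    FarChannelBelowRefS (17 / 16) (1 / 40) μT μN s₀ :=
  fun δ hδ a b w' hst hab ha hb hs hc hg hUC hS ν hν hνa hνb =>
    isFarChannelModulusBelow_of_hess hst hab ha hb hUC (hC δ hδ a b w' hst hab ha hb hs hc hg hUC hS ν hν hνa hνb) hθ hγ hμT hμN

/-- ★★★ THE INGESTION ENDPOINT OF RECORD (TAG 182): four Hessian certificates — adjacent and span-`2..5` block bounds for the T and the S
branch — together with weights and the closing arithmetic of `…PairModulusSharp.tubeConvexRef_record_of_branch_certs₆` (tail budgets `7/10` (T),
`9/4` (S) from `s₀ = 6`, supplied by `pairModulusTailRef_sharp`) give `TubeConvexRef (17/16) (1/40)`. -/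
theorem tubeConvexRef_of_hessCerts₆ {αT αN γ θ lT lN lam B₁T B₁N : ℝ} {αTf αNf γf θf μT μN : ℕ → ℝ}
    (hA : HessCertAdj PhiT αT αN γ) (hθ : 0 < θ) (hγ : 0 ≤ γ) (hlT : lT ≤ αT - θ * γ) (hlN : lN ≤ αN - γ / θ)
    (hF : HessCertFar PhiT αTf αNf γf 6) (hθf : ∀ s, 0 < θf s) (hγf : ∀ s, 0 ≤ γf s) (hμTf : ∀ s, αTf s + θf s * γf s ≤ μT s)
    (hμNf : ∀ s, αNf s + γf s / θf s ≤ μN s) (hμT : ∀ s, 0 ≤ μT s) (hμN : ∀ s, 0 ≤ μN s)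
    (h₁T : ∑ s ∈ Finset.Ico 2 6, ((s : ℕ) : ℝ) ^ 2 * μT s ≤ B₁T) (h₁N : ∑ s ∈ Finset.Ico 2 6, ((s : ℕ) : ℝ) ^ 2 * μN s ≤ B₁N)
    (hlam : 0 < lam) (hlamT : lam + (B₁T + 7 / 10) ≤ lT) (hlamN : lam + (B₁N + 7 / 10) ≤ lN)
    {αT' αN' γ' θ' lT' lN' lam' B₁T' B₁N' : ℝ} {αTf' αNf' γf' θf' μT' μN' : ℕ → ℝ}
    (hA' : HessCertAdj PhiS αT' αN' γ') (hθ' : 0 < θ') (hγ' : 0 ≤ γ') (hlT' : lT' ≤ αT' - θ' * γ') (hlN' : lN' ≤ αN' - γ' / θ')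
    (hF' : HessCertFar PhiS αTf' αNf' γf' 6) (hθf' : ∀ s, 0 < θf' s) (hγf' : ∀ s, 0 ≤ γf' s) (hμTf' : ∀ s, αTf' s + θf' s * γf' s ≤ μT' s)
    (hμNf' : ∀ s, αNf' s + γf' s / θf' s ≤ μN' s) (hμT' : ∀ s, 0 ≤ μT' s) (hμN' : ∀ s, 0 ≤ μN' s)
    (h₁T' : ∑ s ∈ Finset.Ico 2 6, ((s : ℕ) : ℝ) ^ 2 * μT' s ≤ B₁T') (h₁N' : ∑ s ∈ Finset.Ico 2 6, ((s : ℕ) : ℝ) ^ 2 * μN' s ≤ B₁N')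
    (hlam' : 0 < lam') (hlamT' : lam' + (B₁T' + 9 / 4) ≤ lT') (hlamN' : lam' + (B₁N' + 9 / 4) ≤ lN') :
    TubeConvexRef (17 / 16) (1 / 40) :=
  tubeConvexRef_record_of_branch_certs₆ (adjacentChannelRefT_of_hess hA hθ hγ hlT hlN) (farChannelBelowRefT_of_hess hF hθf hγf hμTf hμNf)
    hμT hμN h₁T h₁N hlam hlamT hlamN (adjacentChannelRefS_of_hess hA' hθ' hγ' hlT' hlN') (farChannelBelowRefS_of_hess hF' hθf' hγf' hμTf' hμNf')
    hμT' hμN' h₁T' h₁N' hlam' hlamT' hlamN'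

/-! ### The Hessian form as an explicit lattice series (for matching a computed truncation against `hess`) -/

/-- summability of the pair Jacobians over the sites, off the layer plane (same data as `hasFDerivAt_layerForce`). -/
theorem summable_pairJac {ν a b v : E3} (hν : ‖ν‖ = 1) (hνa : ⟪ν, a⟫ = 0) (hνb : ⟪ν, b⟫ = 0)
    (hab : LinearIndependent ℝ ![a, b]) {t d Rc ε : ℝ} (ht : 0 < t) (hd : 0 < d) (hε : 0 < ε)
    (hRc : ∀ ζ₁ ζ₂ : ℝ, |ζ₁| ≤ 1 / 2 → |ζ₂| ≤ 1 / 2 → ‖ζ₁ • a + ζ₂ • b‖ ≤ Rc)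
    (hT : 0 < (1 + ε) * t ^ 2 - (1 + ε⁻¹) * (d + Rc) ^ 2) (htv : t + d ≤ |⟪ν, v⟫|) :
    Summable (fun ij : ℤ × ℤ => pairJac (v + ((ij.1 : ℝ) • a + (ij.2 : ℝ) • b))) := by
  obtain ⟨c₁, c₂, hc⟩ := exists_planar hab hν hνa hνb v
  set m : ℤ × ℤ → ℝ := fun ij => max (‖((ij.1 : ℝ) + c₁) • a + ((ij.2 : ℝ) + c₂) • b‖ - d) 0 with hm
  obtain ⟨hμ, -⟩ := tsum_modulus_le_smear hab hε hRc hT c₁ c₂ (m := m)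
    (fun ij => by show _ ≤ max _ 0 + d; linarith [le_max_left (‖((ij.1 : ℝ) + c₁) • a + ((ij.2 : ℝ) + c₂) • b‖ - d) 0])
  have hr : ∀ ij : ℤ × ℤ, 0 < Real.sqrt (t ^ 2 + m ij ^ 2) := fun ij => Real.sqrt_pos.2 (by positivity)
  have htv2 : t ^ 2 ≤ ⟪ν, v⟫ ^ 2 := by
    have h3 : t ≤ |⟪ν, v⟫| := by linarith
    nlinarith [sq_abs ⟪ν, v⟫, abs_nonneg ⟪ν, v⟫]
  refine Summable.of_norm_bounded hμ fun ij => norm_pairJac_le (hr ij) ?_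
  exact site_floor hν hνa hνb hc htv2 (by rw [sub_self, norm_zero]; exact hd.le) ij

/-- the layer Jacobian applied: `layerJac a b v D = Σ' J(v + l) D` (given summability of the Jacobians). -/
theorem layerJac_apply {a b v : E3} (hS : Summable (fun ij : ℤ × ℤ => pairJac (v + ((ij.1 : ℝ) • a + (ij.2 : ℝ) • b)))) (D : E3) :
    layerJac a b v D = ∑' ij : ℤ × ℤ, pairJac (v + ((ij.1 : ℝ) • a + (ij.2 : ℝ) • b)) D := by
  unfold layerJac
  simpa only [ContinuousLinearMap.apply_apply] using (ContinuousLinearMap.apply ℝ E3 D).map_tsum hS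

/-- the layer Jacobian FORM as a series: `⟪layerJac a b v D, D⟫ = Σ' ⟪J(v + l) D, D⟫`. -/
theorem inner_layerJac {a b v : E3} (hS : Summable (fun ij : ℤ × ℤ => pairJac (v + ((ij.1 : ℝ) • a + (ij.2 : ℝ) • b)))) (D : E3) :
    ⟪layerJac a b v D, D⟫ = ∑' ij : ℤ × ℤ, ⟪pairJac (v + ((ij.1 : ℝ) • a + (ij.2 : ℝ) • b)) D, D⟫ := by
  have hS' : Summable (fun ij : ℤ × ℤ => pairJac (v + ((ij.1 : ℝ) • a + (ij.2 : ℝ) • b)) D) := by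
    simpa only [ContinuousLinearMap.apply_apply] using (ContinuousLinearMap.apply ℝ E3 D).summable hS
  rw [layerJac_apply hS, real_inner_comm, ← innerSL_apply_apply (𝕜 := ℝ), (innerSL ℝ D).map_tsum hS']
  refine tsum_congr fun ij => ?_
  rw [innerSL_apply_apply, real_inner_comm]

/-- the pair Jacobian form explicitly: `⟪J(y) D, D⟫ = radial(‖y‖²) ‖D‖² + 2 radial′(‖y‖²) ⟪y, D⟫²`. -/
theorem inner_pairJac (y D : E3) : ⟪pairJac y D, D⟫ = radial (‖y‖ ^ 2) * ‖D‖ ^ 2 + 2 * radial' (‖y‖ ^ 2) * ⟪y, D⟫ ^ 2 := by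
  rw [pairJac_apply, inner_add_left, inner_smul_left, inner_smul_left, real_inner_self_eq_norm_sq, real_inner_comm D y]
  simp only [conj_trivial]
  ring

/-- ★ THE HESSIAN FORM AS A LATTICE SERIES on the windows of record: for `x` of height `≥ 13/25` w.r.t. a unit normal `ν₀ ⊥ a, b` and cell
radius `≤ 23/25`, `⟪hess a b x D, D⟫ = −Σ'_{(i,j) ∈ ℤ²} (radial(‖y‖²) ‖D‖² + 2 radial′(‖y‖²) ⟪y, D⟫²)`, `y = −x + i a + j b` (absolutely convergent). -/
theorem inner_hess_eq_tsum {ν₀ a b x : E3} (hν : ‖ν₀‖ = 1) (hνa : ⟪ν₀, a⟫ = 0) (hνb : ⟪ν₀, b⟫ = 0) (hab : LinearIndependent ℝ ![a, b])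
    (hRc : ∀ ζ₁ ζ₂ : ℝ, |ζ₁| ≤ 1 / 2 → |ζ₂| ≤ 1 / 2 → ‖ζ₁ • a + ζ₂ • b‖ ≤ 23 / 25) (hx : 13 / 25 ≤ |⟪ν₀, x⟫|) (D : E3) :
    Summable (fun ij : ℤ × ℤ => pairJac (-x + ((ij.1 : ℝ) • a + (ij.2 : ℝ) • b))) ∧
    ⟪hess a b x D, D⟫ = -∑' ij : ℤ × ℤ,
      (radial (‖-x + ((ij.1 : ℝ) • a + (ij.2 : ℝ) • b)‖ ^ 2) * ‖D‖ ^ 2 +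
        2 * radial' (‖-x + ((ij.1 : ℝ) • a + (ij.2 : ℝ) • b)‖ ^ 2) * ⟪-x + ((ij.1 : ℝ) • a + (ij.2 : ℝ) • b), D⟫ ^ 2) := by
  have hS := summable_pairJac (v := -x) hν hνa hνb hab (t := 1 / 2) (d := 1 / 50) (Rc := 23 / 25) (ε := 4) (by norm_num) (by norm_num)
    (by norm_num) hRc (by norm_num) (by rw [inner_neg_right, abs_neg]; linarith)
  refine ⟨hS, ?_⟩
  rw [hess, show (-layerJac a b (-x)) D = -(layerJac a b (-x) D) from rfl, inner_neg_left, inner_layerJac hS]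
  congr 1
  exact tsum_congr fun ij => inner_pairJac _ _

end Summit.AtomisticToContinuum.Crystallization.Theorems.ChartedPlanarOrderChannelJacobian
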